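import Mathlib.RingTheory.MvPolynomial.WeightedHomogeneous
import Mathlib.RingTheory.FiniteType
import Mathlib.RingTheory.RegularLocalRing.Polynomial
import Mathlib.Algebra.Order.Antidiag.Finsupp
import Mathlib.RingTheory.Spectrum.Prime.Basic
import Literature.AlgebraicGeometry.Resolution.AffineBlowupAlgebra
import Literature.AlgebraicGeometry.Resolution.AffineBlowup
import HarnessLib

/-!
# Cone programme: the vertex is the only point of the Segre cone `Spec k[xᵢyⱼ]` on all `xᵢyⱼ = 0`

Support file for crux stmt-ResolutionOfSingularities-15317 (`FrobeniusLadder.FRationalResolution`), line `redirect`,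
lead c5, CONE PROGRAMME (rung 4′ in all dimensions on the Veronese cones `V(n,r) = Spec k[χᵈ : |d| = r]`; this
file treats the companion Segre cones `Spec k[xᵢyⱼ]`, the affine cones over `ℙᵃ⁻¹ × ℙᵇ⁻¹`). Stub
`stub_segre_point_eq`.

Let `R = SR[a,b] = k[xᵢyⱼ : i < a, j < b] ⊆ k[x₁,…,xₐ,y₁,…,y_b]` and let `P` be an ideal of `R` containing
every generator `xᵢyⱼ`.

* `segreVertex_sub_const_mem` — every `t ∈ R` satisfies `t - t(0) ∈ P`, `t(0)` the constant coefficient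
  (`Algebra.adjoin_induction`: true for the generators, which have zero constant term, for the constants, and
  preserved under sums and products since `xy - x(0)y(0) = x (y - y(0)) + (x - x(0)) y(0)`);
* `segreVertex_mem_iff` — hence for `P` prime, `t ∈ P ↔ t(0) = 0` (a nonzero constant is a unit);
* `stub_segre_point_eq` — two primes containing all `xᵢyⱼ` coincide (registered signature; its bipartite
  splitting and membership hypotheses are part of the registered interface but are not needed by this argument).

All folklore (the irrelevant ideal of a standard graded `k`-algebra generated in degree one is the unique
homogeneous maximal ideal; Bruns–Herzog 1998 §1.5, §6.1 context); only Mathlib's `MvPolynomial` /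
`Algebra.adjoin` / `Ideal` API is used; no named facts. [folklore]
-/

-- single-problem summit: the doubled namespace component is forced
set_option linter.dupNamespace false

noncomputable section

namespace Summit.ResolutionOfSingularities.ResolutionOfSingularities.Theorems.FRationalResolution

open MvPolynomial AlgebraicGeometry
open Literature.AlgebraicGeometry.Resolution

section Cones

variable (k : Type) [Field k]

/-- The polynomial ring in two blocks of `a` and `b` variables `xᵢ = X (inl i)`, `yⱼ = X (inr j)`. -/
local notation3 "SP[" a ", " b "]" => MvPolynomial (Fin a ⊕ Fin b) k

/-- The Segre ring `k[xᵢyⱼ] ⊆ k[x, y]`: coordinate ring of the affine cone over the Segre embedding of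
`ℙᵃ⁻¹ × ℙᵇ⁻¹`. -/
local notation3 "SR[" a ", " b "]" =>
  Algebra.adjoin k (Set.range (fun ij : Fin a × Fin b =>
    (MvPolynomial.X (Sum.inl ij.1) * MvPolynomial.X (Sum.inr ij.2) : MvPolynomial (Fin a ⊕ Fin b) k)))

/-- **Every element of `SR[a,b]` is its constant term modulo an ideal through the vertex.** If an ideal `P`
of the Segre ring `SR[a,b] = k[xᵢyⱼ]` contains every generator `xᵢyⱼ`, then `t - t(0) ∈ P` for every
`t ∈ SR[a,b]`, where `t(0)` is the constant coefficient of `t` viewed in `k[x, y]`. Proof by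
`Algebra.adjoin_induction`: the generators have zero constant term and lie in `P`; constants `c` give
`c - c = 0`; sums are clear; and for products `xy - x(0)y(0) = x (y - y(0)) + (x - x(0)) y(0)`. [folklore] -/
theorem segreVertex_sub_const_mem (a b : ℕ) (P : Ideal ↥SR[a, b])
    (hP : ∀ v : ↥SR[a, b], (∃ ij : Fin a × Fin b,
      (v : SP[a, b]) = MvPolynomial.X (Sum.inl ij.1) * MvPolynomial.X (Sum.inr ij.2)) → v ∈ P)
    (t : ↥SR[a, b]) :
    t - algebraMap k ↥SR[a, b] (MvPolynomial.constantCoeff (t : SP[a, b])) ∈ P := by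
  obtain ⟨t, ht⟩ := t
  refine Algebra.adjoin_induction
    (p := fun u hu => (⟨u, hu⟩ : ↥SR[a, b]) - algebraMap k ↥SR[a, b] (constantCoeff u) ∈ P)
    ?_ ?_ ?_ ?_ ht
  · -- generators `xᵢyⱼ`
    rintro _ ⟨ij, rfl⟩
    rw [map_mul, constantCoeff_X, constantCoeff_X, mul_zero, map_zero, sub_zero]
    exact hP _ ⟨ij, rfl⟩
  · -- constants
    intro c
    have hc : (⟨algebraMap k SP[a, b] c, algebraMap_mem _ c⟩ : ↥SR[a, b]) = algebraMap k ↥SR[a, b] c :=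
      Subtype.ext rfl
    rw [hc, MvPolynomial.algebraMap_eq, constantCoeff_C, sub_self]
    exact P.zero_mem
  · -- sums
    intro x y hx hy ihx ihy
    have he : (⟨x + y, add_mem hx hy⟩ : ↥SR[a, b]) = ⟨x, hx⟩ + ⟨y, hy⟩ := rfl
    rw [he, map_add, map_add, add_sub_add_comm]
    exact P.add_mem ihx ihy
  · -- products
    intro x y hx hy ihx ihy
    have he : (⟨x * y, mul_mem hx hy⟩ : ↥SR[a, b]) = ⟨x, hx⟩ * ⟨y, hy⟩ := rfl
    rw [he, map_mul, map_mul]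
    have hxy : (⟨x, hx⟩ : ↥SR[a, b]) * ⟨y, hy⟩ -
        algebraMap k ↥SR[a, b] (constantCoeff x) * algebraMap k ↥SR[a, b] (constantCoeff y) =
        ⟨x, hx⟩ * (⟨y, hy⟩ - algebraMap k ↥SR[a, b] (constantCoeff y)) +
          (⟨x, hx⟩ - algebraMap k ↥SR[a, b] (constantCoeff x)) *
            algebraMap k ↥SR[a, b] (constantCoeff y) := by
      ring
    rw [hxy]
    exact P.add_mem (Ideal.mul_mem_left P _ ihy) (Ideal.mul_mem_right _ P ihx)

/-- **Primes through the vertex of the Segre cone are determined.** For a prime ideal `P` of `SR[a,b]`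
containing every `xᵢyⱼ` and `t ∈ SR[a,b]`: `t ∈ P ↔ t(0) = 0` (`t(0)` the constant coefficient).
`⇐`: `segreVertex_sub_const_mem`; `⇒`: otherwise the unit `t(0) = t - (t - t(0))` lies in `P`. [folklore] -/
theorem segreVertex_mem_iff (a b : ℕ) (P : Ideal ↥SR[a, b]) [hP : P.IsPrime]
    (hgen : ∀ v : ↥SR[a, b], (∃ ij : Fin a × Fin b,
      (v : SP[a, b]) = MvPolynomial.X (Sum.inl ij.1) * MvPolynomial.X (Sum.inr ij.2)) → v ∈ P)
    (t : ↥SR[a, b]) :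
    t ∈ P ↔ MvPolynomial.constantCoeff (t : SP[a, b]) = 0 := by
  have h := segreVertex_sub_const_mem k a b P hgen t
  refine ⟨fun ht => ?_, fun hc => by rwa [hc, map_zero, sub_zero] at h⟩
  by_contra hc
  refine hP.ne_top (Ideal.eq_top_of_isUnit_mem P ?_ ((IsUnit.mk0 _ hc).map (algebraMap k ↥SR[a, b])))
  have h' := P.sub_mem ht h
  rwa [sub_sub_cancel] at h'

-- `hsplit`, `hmem` are part of the registered signature but unused by this proof
set_option linter.unusedVariables false in
/-- **THE VERTEX IS THE ONLY POINT OF THE SEGRE CONE WITH ALL `xᵢyⱼ = 0`** (registered stub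
`stub_segre_point_eq`, crux stmt-ResolutionOfSingularities-15317, line `redirect`). Two primes `P, Q` of the
Segre ring `SR[a,b] = k[xᵢyⱼ]` containing every generator `xᵢyⱼ` coincide: each is the set of elements with
vanishing constant coefficient (`segreVertex_mem_iff`), i.e. the homogeneous maximal ideal, kernel of the
constant coefficient `SR[a,b] → k`. The bipartite-splitting hypothesis `hsplit` and the membership criterion
`hmem` belong to the registered interface of the cone programme (they give the alternative monomial-by-monomial
proof) but the adjoin-induction argument used here does not need them, whence the `unusedVariables` linter is
switched off for this one declaration. [folklore] -/
theorem stub_segre_point_eq (a b : ℕ)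
    (hsplit : ∀ (s : ℕ) (d : Fin a ⊕ Fin b →₀ ℕ), ∑ i : Fin a, d (Sum.inl i) = s →
      ∑ j : Fin b, d (Sum.inr j) = s → ∃ e : Fin s → Fin a × Fin b,
        d = ∑ l, (Finsupp.single (Sum.inl (e l).1) 1 + Finsupp.single (Sum.inr (e l).2) 1))
    (hmem : ∀ f : SP[a, b], f ∈ SR[a, b] ↔
      ∀ d ∈ f.support, ∑ i : Fin a, d (Sum.inl i) = ∑ j : Fin b, d (Sum.inr j))
    (P Q : PrimeSpectrum ↥SR[a, b])
    (hP : ∀ v : ↥SR[a, b], (∃ ij : Fin a × Fin b,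
      (v : SP[a, b]) = MvPolynomial.X (Sum.inl ij.1) * MvPolynomial.X (Sum.inr ij.2)) → v ∈ P.asIdeal)
    (hQ : ∀ v : ↥SR[a, b], (∃ ij : Fin a × Fin b,
      (v : SP[a, b]) = MvPolynomial.X (Sum.inl ij.1) * MvPolynomial.X (Sum.inr ij.2)) → v ∈ Q.asIdeal) :
    P = Q := by
  ext t
  rw [segreVertex_mem_iff k a b P.asIdeal hP t, segreVertex_mem_iff k a b Q.asIdeal hQ t]

end Cones

end Summit.ResolutionOfSingularities.ResolutionOfSingularities.Theorems.FRationalResolution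

end
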